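import Summits.CriticalPhenomena.PercolationContinuityZ3.Theorems.Transplant.FKConnectivityAllQForestTransversal
import HarnessLib

/-!
# MONO ⇒ D1 ⇒ (♣)⁰: neighbour monotonicity of the transversal margin implies the star–edge family; D1 = the `K = ∅` slice of g20's (QS-K)

Support file (`--supports stmt-CriticalPhenomena-4575`), FK sub-lane `prim-bschramm-fk-1` (generation 32) of the post-continuity
programme; builds on p205010 (kernel theorem, internal audit signed; external expert review pending).  Theorems only (the two nodes
`ForestTransversalOn` = D1 and `ForestTransversalMonoOn` = MONO live in `…ForestTransversal`, NOT asserted); no named facts, no sorries;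
standard axioms; the whole file elaborates at `maxHeartbeats 120000`.

Notation of `…ForestTransversal`: `Θ(Z;o;w) = #(Fo ∩ T_Z, Fo ∩ {o ≁ w}) − #(Fo ∩ T_{Z ∪ {w}}, Fo)` on a fibre `(M, u₀)`, `o ∈ Z ∌ w`.
RECORD (memo bschramm/FROM-fk-1-g32-TRANSVERSAL.md §0): D1 ("`Θ ≥ 0`", star–edge coefficientwise negative correlation) is NOT new to the
lineage — it is the `K = ∅` part of g20's QUOTIENT MONOTONICITY (QS-K) = STAR NEGATIVE CORRELATION (memo bschramm/FROM-fk-1-g20-SEPARATOR-EXCHANGE.md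
§3d, kernel schema `hQ` of `…ForestQuotientMono` / `…ForestNodeOfQuotientMono`, whose `|S| = 1` slice is (♣)⁰), and g31's detour lemma
`DetourOn` is g20's 3-terminal inequality §3d(★) with its fixed-path refinement §3d(a).  **`forestTransversalOn_of_quotientMono`** records the
first identification in the kernel ((QS-K) schema ⇒ `ForestTransversalOn V`).  What this generation adds: the named node, the exhaustive
censuses (n ≤ 9 all `Z`, n = 10 running, multigraphs n ≤ 8), and the NEW local node MONO with the reduction below.

* Two unconditional members of the D1 family: **`forestTransversal_singleton`** (`Z = {o}`: an equality case, by the involution `ω ↦ ω ∆ M`) and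
  **`forestTransversal_of_root_adjacent`** (`ow` a free pair: move it to the first class — the doubled-`f` degenerate case of the node).
* **`forestTransversal_base`** (THE BASE CASE, a theorem): if every pair of `M ∪ u₀` meeting `Z` lies inside `Z ∪ {w}`, then `Θ(Z;o;w) ≥ 0`.
  PROOF: on a colouring whose first class `ω` is `(Z ∪ {w})`-transversal and whose second class `ζ = ω ∆ M` joins `o` to `w`, the `ζ`-path from
  `o` stays inside `Z` until it enters `w` through its LAST pair `g = xw`, `x ∈ Z` (walk induction `exists_last_pair` + the closed-set lemma
  `mem_of_reachable_of_closed`); `g` is free and not in `ω` (else `x ~ w` in `ω`), and `ω ↦ ω ∪ {g}` lands in (`Z`-transversal, `o ≁ w`):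
  the first class stays a forest and `Z`-transversal (`reachable_insert_or_detour`; `w`'s old cluster avoids `Z`), the second class `ζ ∖ {g}`
  no longer joins `o` to `w` (it still joins `o` to `x`, and `x ≁ w` there since `ζ` is a forest through `g`).  Colourings whose second class
  already separates `o, w` are kept.  Injectivity: `g` is the unique first-class pair from `w` into `Z`.
* **`forestTransversalOn_of_mono : ForestTransversalMonoOn V → ForestTransversalOn V`**: strong induction on `|V ∖ Z|` — while some
  `u ∉ Z ∪ {w}` is joined to `Z` by a pair of the fibre, MONO gives `Θ(Z;o;w) ≥ Θ(Z ∪ {u};o;w) ≥ 0`; otherwise the base case.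
* **`adjForestRayleighNoSqOn_of_forestTransversalMono`**, **`adjForestRayleighNoSqPos_of_forestTransversalMonoPos`**: with
  `adjForestRayleighNoSqOn_of_forestTransversal` of `…ForestTransversal`, ONE local monotonicity statement implies (♣)⁰ (and with it (QS-∅),
  g20's §3d(★) = g31's `DetourOn`, and the whole star–edge family).
EVIDENCE for MONO (exact, exhaustive, isomorph-free; engine numerics32/dlr/dlr.c of the seat; kit j238299/j238301/j238407): all connected simple
graphs with n ≤ 9 vertices (n = 9: 1,710,289,727 `(Z,o,w,u)` tests with `u ∈ N(Z)`), all multigraphs with multiplicity ≤ 2 (doubled = pinned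
pairs) on ≤ 8 vertices (n = 8: 2,074,723,566 tests), random sparse graphs n ≤ 13 (3.25 M non-trivial tests): 0 failures; FALSE for `u ∉ N(Z)`
(6,503,544 failures at n = 9).  Memo bschramm/FROM-fk-1-g32-TRANSVERSAL.md.
[cite: SempleWelsh2008, Conj. 1.1 (p. 2); Thm. 4.2 (p. 11)] [cite: CibulkaHladkyLaCroixWagner2008, Thm. 1 (p. 2)] [cite: Linusson2011, Prop. 2.6]
[cite: Grimmett2006, §1.5 (p. 13)]
-/

noncomputable section

namespace Summit.CriticalPhenomena.PercolationContinuityZ3.Theorems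
namespace FK

open Set Literature.Probability.LatticeModels Literature.Probability.Percolation
open scoped Classical symmDiff

variable {V : Type*} [Fintype V]

/-! ### MONO ⇒ D1: descent along neighbours and the base case -/

section MonoToTransversal

variable {M u₀ : BondConfig V}

omit [Fintype V] in
/-- **Last pair of a path** (walk induction): if `a ≠ c` are joined by a walk of `ζ` and `o` reaches `a` avoiding every pair at `c`, then some
`x ≠ c` with `xc ∈ ζ` is reached from `o` avoiding every pair at `c`. [folklore] -/
theorem exists_last_pair_aux (ζ : BondConfig V) (o : V) :
    ∀ {a c : V} (_ : (openGraph ζ).Walk a c), a ≠ c → (openGraph (ζ \ {q | c ∈ q})).Reachable o a →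
      ∃ x, x ≠ c ∧ s(x, c) ∈ ζ ∧ (openGraph (ζ \ {q | c ∈ q})).Reachable o x := by
  intro a c p
  induction p with
  | nil => exact fun h _ => absurd rfl h
  | @cons a b c hadj q ih =>
    intro hac hoa
    obtain ⟨hab, hne⟩ := (openGraph_adj _ _ _).1 hadj
    by_cases hbc : b = c
    · subst hbc; exact ⟨a, hne, hab, hoa⟩
    · have hcq : c ∉ s(a, b) := by
        rw [Sym2.mem_iff]; push Not
        exact ⟨fun h => hac h.symm, fun h => hbc h.symm⟩
      have hadj' : (openGraph (ζ \ {q | c ∈ q})).Adj a b := (openGraph_adj _ _ _).2 ⟨⟨hab, hcq⟩, hne⟩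
      exact ih hbc (hoa.trans hadj'.reachable)

omit [Fintype V] in
/-- **Last pair of a path**: if `o ≠ w` are joined in `ζ`, some `x ≠ w` with `xw ∈ ζ` is reached from `o` avoiding every pair at `w`.
[folklore] -/
theorem exists_last_pair {ζ : BondConfig V} {o w : V} (how : o ≠ w) (h : (openGraph ζ).Reachable o w) :
    ∃ x, x ≠ w ∧ s(x, w) ∈ ζ ∧ (openGraph (ζ \ {q | w ∈ q})).Reachable o x := by
  obtain ⟨p⟩ := h
  exact exists_last_pair_aux ζ o p how SimpleGraph.Reachable.rfl

omit [Fintype V] in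
/-- Adding a free pair absent from the configuration removes it from the partner. [folklore] -/
theorem insert_symmDiff_of_mem_of_notMem {ω : BondConfig V} {g : Sym2 V} (hgM : g ∈ M) (hgω : g ∉ ω) :
    insert g ω ∆ M = (ω ∆ M) \ {g} := by
  ext x
  simp only [Set.mem_symmDiff, mem_insert_iff, mem_sdiff, mem_singleton_iff]
  by_cases hx : x = g
  · subst hx; tauto
  · tauto

/-- **THE BASE CASE of the descent.**  If every pair of the fibre meeting `Z` lies inside `Z ∪ {w}` then D1 holds at `(Z; o; w)`: the map
"if the second class joins `o` to `w`, move the LAST pair `xw` (`x ∈ Z`) of its `o–w` path to the first class" injects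
`#(Fo ∩ T_{Z+w}, Fo)` into `#(Fo ∩ T_Z, Fo ∩ {o ≁ w})` (the moved pair is recovered as the unique first-class pair from `w` into `Z`).
[cite: SempleWelsh2008, Conj. 1.1 (p. 2)] [cite: Linusson2011, Prop. 2.6] -/
theorem forestTransversal_base {Z : Finset V} {o w : V} (hoZ : o ∈ Z) (hwZ : w ∉ Z)
    (hcl : ∀ z ∈ Z, ∀ b, s(z, b) ∈ M ∪ u₀ → b ∈ Z ∨ b = w) :
    fibreCount M u₀ (forestEv V ∩ transvEv (insert w Z)) (forestEv V) ≤
      fibreCount M u₀ (forestEv V ∩ transvEv Z) (forestEv V ∩ (reachEv o w)ᶜ) := by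
  have how : o ≠ w := fun h => hwZ (h ▸ hoZ)
  -- the predicate "the second class joins o to w, with last pair xw" and the map
  let P : BondConfig V → Prop := fun ω =>
    ∃ x, x ∈ Z ∧ s(x, w) ∈ ω ∆ M ∧ s(x, w) ∉ ω ∧ (openGraph ((ω ∆ M) \ {s(x, w)})).Reachable o x
  let φ : BondConfig V → BondConfig V := fun ω => if h : P ω then insert s(h.choose, w) ω else ω
  -- in the source, no first-class pair joins `w` to a point of `Z`
  have key : ∀ {ω : BondConfig V}, ω ∈ forestEv V ∩ transvEv (insert w Z) → ∀ x ∈ Z, s(x, w) ∉ ω := by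
    rintro ω ⟨-, hT⟩ x hxZ hg
    have hxw : x ≠ w := fun h => hwZ (h ▸ hxZ)
    exact (mem_transvEv_insert.1 hT).2 x hxZ hxw ((openGraph_adj _ _ _).2 ⟨hg, hxw⟩).reachable
  refine fibreCount_le_of_injOn φ (fun ω hω hA hB => ?_) (fun ω ω' hω hA hB hω' hA' hB' h => ?_)
  · obtain ⟨hF, hT⟩ := hA
    have hTZ : ω ∈ transvEv Z := (mem_transvEv_insert.1 hT).1
    have hTw : ∀ z ∈ Z, z ≠ w → ¬ (openGraph ω).Reachable z w := (mem_transvEv_insert.1 hT).2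
    have hFB : IsForestCfg (ω ∆ M) := hB
    by_cases hP : P ω
    · have hφ : φ ω = insert s(hP.choose, w) ω := dif_pos hP
      obtain ⟨hxZ, hgζ, hgω, hox⟩ := hP.choose_spec
      set x := hP.choose with hxdef
      have hxw : x ≠ w := fun h' => hwZ (h' ▸ hxZ)
      have hgM : s(x, w) ∈ M := by
        rcases Set.mem_symmDiff.1 hgζ with ⟨h1, -⟩ | ⟨h1, -⟩
        · exact absurd h1 hgω
        · exact h1
      rw [hφ]
      refine ⟨by rw [insert_sdiff_of_mem _ hgM, hω], ⟨(isForestCfg_insert_iff hxw hgω).2 ⟨hF, hTw x hxZ hxw⟩, ?_⟩, ?_⟩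
      · -- first class stays `Z`-transversal
        intro z hz z' hz' hne hr
        have hz'w : z' ≠ w := fun h' => hwZ (h' ▸ hz')
        have hzw : z ≠ w := fun h' => hwZ (h' ▸ hz)
        rcases reachable_insert_or_detour ω x w hr with hr | ⟨h1, h2⟩
        · exact hTZ hz hz' hne hr
        · rcases h2 with h2 | h2
          · by_cases hxz' : x = z'
            · subst hxz'
              rcases h1 with h1 | h1
              · exact hTZ hz hxZ hne h1
              · exact hTw z hz hzw h1
            · exact hTZ hxZ hz' hxz' h2
          · exact hTw z' hz' hz'w h2.symm
      · -- second class: `ζ ∖ {xw}`, a forest not joining `o` to `w`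
        show insert s(x, w) ω ∆ M ∈ forestEv V ∩ (reachEv o w)ᶜ
        rw [insert_symmDiff_of_mem_of_notMem hgM hgω]
        refine ⟨forestEv_of_subset hB sdiff_subset, fun hr => ?_⟩
        have hζ : insert s(x, w) ((ω ∆ M) \ {s(x, w)}) = ω ∆ M := by
          rw [insert_sdiff_singleton, insert_eq_of_mem hgζ]
        have hsep : ¬ (openGraph ((ω ∆ M) \ {s(x, w)})).Reachable x w :=
          ((isForestCfg_insert_iff hxw (fun h' : s(x, w) ∈ (ω ∆ M) \ {s(x, w)} => h'.2 rfl)).1 (hζ.symm ▸ hFB)).2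
        exact hsep (hox.symm.trans hr)
    · have hφ : φ ω = ω := dif_neg hP
      rw [hφ]
      refine ⟨hω, ⟨hF, hTZ⟩, hB, fun hr => hP ?_⟩
      -- the second class joins `o` to `w`: find the last pair, it starts in `Z`
      have hr' : (openGraph (ω ∆ M)).Reachable o w := hr
      obtain ⟨x, hxw, hgζ, hox⟩ := exists_last_pair how hr'
      have hsub := (subset_union_of_fibre hω).2
      have hxZ : x ∈ Z := by
        obtain ⟨p⟩ := hox
        have hA : ∀ a b, (openGraph ((ω ∆ M) \ {q | w ∈ q})).Adj a b → a ∈ (Z : Set V) → b ∈ (Z : Set V) := by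
          intro a b hab ha
          obtain ⟨⟨habζ, hwab⟩, -⟩ := (openGraph_adj _ _ _).1 hab
          rcases hcl a ha b (hsub habζ) with hb | hb
          · exact hb
          · exact absurd (hb ▸ Sym2.mem_mk_right a b : w ∈ s(a, b)) hwab
        exact mem_of_reachable_of_closed hA p (Finset.mem_coe.2 hoZ)
      refine ⟨x, hxZ, hgζ, key ⟨hF, hT⟩ x hxZ, hox.mono (openGraph_mono fun q hq => ⟨hq.1, fun h' => hq.2 ?_⟩)⟩
      rw [mem_singleton_iff.1 h']; exact Sym2.mem_mk_right _ _
  · -- injectivity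
    have k1 := key hA
    have k2 := key hA'
    by_cases hP : P ω <;> by_cases hP' : P ω'
    · have h1 : φ ω = insert s(hP.choose, w) ω := dif_pos hP
      have h2 : φ ω' = insert s(hP'.choose, w) ω' := dif_pos hP'
      rw [h1, h2] at h
      have hx := hP.choose_spec.1
      have hx' := hP'.choose_spec.1
      have hg' : s(hP'.choose, w) ∈ insert s(hP.choose, w) ω := by rw [h]; exact mem_insert _ _
      rcases mem_insert_iff.1 hg' with hgg | hgg
      · have hnot : s(hP.choose, w) ∉ ω := k1 _ hx
        have hnot' : s(hP'.choose, w) ∉ ω' := k2 _ hx'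
        rw [← insert_sdiff_self_of_notMem hnot, h, ← hgg, insert_sdiff_self_of_notMem (hgg ▸ hnot')]
      · exact absurd hgg (k1 _ hx')
    · have h1 : φ ω = insert s(hP.choose, w) ω := dif_pos hP
      have h2 : φ ω' = ω' := dif_neg hP'
      rw [h1, h2] at h
      exact absurd (h ▸ mem_insert _ _ : s(hP.choose, w) ∈ ω') (k2 _ hP.choose_spec.1)
    · have h1 : φ ω = ω := dif_neg hP
      have h2 : φ ω' = insert s(hP'.choose, w) ω' := dif_pos hP'
      rw [h1, h2] at h
      exact absurd (h.symm ▸ mem_insert _ _ : s(hP'.choose, w) ∈ ω) (k1 _ hP'.choose_spec.1)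
    · have h1 : φ ω = ω := dif_neg hP
      have h2 : φ ω' = ω' := dif_neg hP'
      rwa [h1, h2] at h

/-- **D1 at a singleton `Z = {o}` is an equality case (holds unconditionally):** `#(Fo ∩ T_{o,w}, Fo) ≤ #(Fo ∩ T_{o}, Fo ∩ {o ≁ w})` — both sides count
the colourings whose one class separates `o` from `w` (the involution `ω ↦ ω ∆ M`). [cite: Linusson2011, Prop. 2.6] -/
theorem forestTransversal_singleton (M u₀ : BondConfig V) (o w : V) (how : o ≠ w) :
    fibreCount M u₀ (forestEv V ∩ transvEv (insert w ({o} : Finset V))) (forestEv V) ≤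
      fibreCount M u₀ (forestEv V ∩ transvEv ({o} : Finset V)) (forestEv V ∩ (reachEv o w)ᶜ) := by
  rw [fibreCount_swap M u₀ (forestEv V ∩ transvEv ({o} : Finset V))]
  refine fibreCount_mono_fibre M u₀ fun ω _ hA hB => ⟨⟨hA.1, fun hr => ?_⟩, hB, mem_transvEv_singleton⟩
  exact (mem_transvEv_pair (Ne.symm how)).1 hA.2 hr.symm

/-- **D1 when `w` is adjacent to the root `o` by a free pair is a THEOREM** (the doubled-`f` degenerate case; memo (D1⁺)): moving `g = ow` from the
second class to the first injects `#(Fo ∩ T_{Z+w}, Fo)` into `#(Fo ∩ T_Z, Fo ∩ {o ≁ w})` — the second class, a forest through `g`, cannot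
also join `o` to `w` avoiding `g`. [cite: SempleWelsh2008, Conj. 1.1 (p. 2)] [cite: Linusson2011, Prop. 2.6] -/
theorem forestTransversal_of_root_adjacent {Z : Finset V} {o w : V} (hoZ : o ∈ Z) (hwZ : w ∉ Z) (hgM : s(o, w) ∈ M) :
    fibreCount M u₀ (forestEv V ∩ transvEv (insert w Z)) (forestEv V) ≤
      fibreCount M u₀ (forestEv V ∩ transvEv Z) (forestEv V ∩ (reachEv o w)ᶜ) := by
  have how : o ≠ w := fun h => hwZ (h ▸ hoZ)
  refine fibreCount_le_of_injOn (fun ω => insert s(o, w) ω) (fun ω hω hA hB => ?_) (fun ω ω' _ hA _ _ hA' _ h => ?_)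
  · obtain ⟨hF, hT⟩ := hA
    have hTZ : ω ∈ transvEv Z := (mem_transvEv_insert.1 hT).1
    have hTw : ∀ z ∈ Z, z ≠ w → ¬ (openGraph ω).Reachable z w := (mem_transvEv_insert.1 hT).2
    have hgω : s(o, w) ∉ ω := fun h => hTw o hoZ how ((openGraph_adj _ _ _).2 ⟨h, how⟩).reachable
    have hgζ : s(o, w) ∈ ω ∆ M := Set.mem_symmDiff.2 (Or.inr ⟨hgM, hgω⟩)
    have hFB : IsForestCfg (ω ∆ M) := hB
    refine ⟨by rw [insert_sdiff_of_mem _ hgM, hω], ⟨(isForestCfg_insert_iff how hgω).2 ⟨hF, hTw o hoZ how⟩, ?_⟩, ?_⟩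
    · intro z hz z' hz' hne hr
      have hz'w : z' ≠ w := fun h' => hwZ (h' ▸ hz')
      have hzw : z ≠ w := fun h' => hwZ (h' ▸ hz)
      rcases reachable_insert_or_detour ω o w hr with hr | ⟨h1, h2⟩
      · exact hTZ hz hz' hne hr
      · rcases h2 with h2 | h2
        · by_cases hoz' : o = z'
          · subst hoz'
            rcases h1 with h1 | h1
            · exact hTZ hz hoZ hne h1
            · exact hTw z hz hzw h1
          · exact hTZ hoZ hz' hoz' h2
        · exact hTw z' hz' hz'w h2.symm
    · show insert s(o, w) ω ∆ M ∈ forestEv V ∩ (reachEv o w)ᶜ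
      rw [insert_symmDiff_of_mem_of_notMem hgM hgω]
      refine ⟨forestEv_of_subset hB sdiff_subset, fun hr => ?_⟩
      have hζ : insert s(o, w) ((ω ∆ M) \ {s(o, w)}) = ω ∆ M := by rw [insert_sdiff_singleton, insert_eq_of_mem hgζ]
      exact ((isForestCfg_insert_iff how (fun h' : s(o, w) ∈ (ω ∆ M) \ {s(o, w)} => h'.2 rfl)).1 (hζ.symm ▸ hFB)).2 hr
  · have k1 : s(o, w) ∉ ω := fun hg =>
      (mem_transvEv_insert.1 hA.2).2 o hoZ how ((openGraph_adj _ _ _).2 ⟨hg, how⟩).reachable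
    have k2 : s(o, w) ∉ ω' := fun hg =>
      (mem_transvEv_insert.1 hA'.2).2 o hoZ how ((openGraph_adj _ _ _).2 ⟨hg, how⟩).reachable
    have h' : insert s(o, w) ω = insert s(o, w) ω' := h
    rw [← insert_sdiff_self_of_notMem k1, h', insert_sdiff_self_of_notMem k2]

/-- **MONO ⇒ D1: `ForestTransversalMonoOn V → ForestTransversalOn V`.**  Strong induction on the number of vertices outside `Z`: while some
`u ∉ Z ∪ {w}` is joined to `Z` by a pair of the fibre, MONO bounds `Θ(Z;o;w)` below by `Θ(Z ∪ {u};o;w) ≥ 0` (induction); otherwise the base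
case `forestTransversal_base`.  Hence MONO implies (♣)⁰, the detour lemma and the whole star–edge family.
[cite: SempleWelsh2008, Conj. 1.1 (p. 2); Thm. 4.2 (p. 11)] [cite: CibulkaHladkyLaCroixWagner2008, Thm. 1 (p. 2)] [cite: Linusson2011, Prop. 2.6] -/
theorem forestTransversalOn_of_mono (hmono : ForestTransversalMonoOn V) : ForestTransversalOn V := by
  intro M u₀ hd
  suffices H : ∀ (k : ℕ) (Z : Finset V) (o w : V), (Finset.univ \ Z).card = k → o ∈ Z → w ∉ Z →
      fibreCount M u₀ (forestEv V ∩ transvEv (insert w Z)) (forestEv V) ≤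
        fibreCount M u₀ (forestEv V ∩ transvEv Z) (forestEv V ∩ (reachEv o w)ᶜ) from
    fun Z o w => H _ Z o w rfl
  intro k
  induction k using Nat.strong_induction_on with
  | _ k ih =>
  intro Z o w hk hoZ hwZ
  by_cases hex : ∃ u z, u ∉ Z ∧ u ≠ w ∧ z ∈ Z ∧ z ≠ u ∧ s(z, u) ∈ M ∪ u₀
  · obtain ⟨u, z, huZ, huw, hzZ, hzu, hzu'⟩ := hex
    have hm := hmono M u₀ hd Z o w u z hoZ hwZ huZ huw hzZ hzu hzu'
    have hlt : (Finset.univ \ insert u Z).card < k := by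
      rw [← hk, Finset.sdiff_insert]
      exact Finset.card_erase_lt_of_mem (Finset.mem_sdiff.2 ⟨Finset.mem_univ u, huZ⟩)
    have hwZ' : w ∉ insert u Z := by
      rw [Finset.mem_insert]; push Not; exact ⟨Ne.symm huw, hwZ⟩
    have hih := ih _ hlt (insert u Z) o w rfl (Finset.mem_insert_of_mem hoZ) hwZ'
    omega
  · push Not at hex
    refine forestTransversal_base hoZ hwZ fun z hz b hb => ?_
    by_contra hcon
    push Not at hcon
    by_cases hzb : z = b
    · exact hcon.1 (hzb ▸ hz)
    · exact hex b z hcon.1 hcon.2 hz hzb hb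

/-- **`ForestTransversalMonoOn V → AdjForestRayleighNoSqOn V`**: neighbour monotonicity of the transversal margin implies the square-free
adjacent forest Rayleigh node. [cite: SempleWelsh2008, Conj. 1.1 (p. 2)] [cite: Linusson2011, Prop. 2.6] -/
theorem adjForestRayleighNoSqOn_of_forestTransversalMono (hmono : ForestTransversalMonoOn V) : AdjForestRayleighNoSqOn V :=
  adjForestRayleighNoSqOn_of_forestTransversal (forestTransversalOn_of_mono hmono)

/-- **`ForestTransversalMonoPos → ForestTransversalPos`.** [cite: SempleWelsh2008, Conj. 1.1 (p. 2)] -/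
theorem forestTransversalPos_of_monoPos (h : ForestTransversalMonoPos) : ForestTransversalPos :=
  fun n => forestTransversalOn_of_mono (h n)

/-- **`ForestTransversalMonoPos → AdjForestRayleighNoSqPos`** — one local monotonicity statement implies (♣)⁰ and with it the lineage's chain
(♣) ⇒ FRM ⇒ (A′) ⇒ (A) ⇒ (B′) ⇒ (B). [cite: SempleWelsh2008, Conj. 1.1 (p. 2)] [cite: Grimmett2006, Thm. 3.8 (p. 43)] -/
theorem adjForestRayleighNoSqPos_of_forestTransversalMonoPos (h : ForestTransversalMonoPos) : AdjForestRayleighNoSqPos :=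
  adjForestRayleighNoSqPos_of_forestTransversalPos (forestTransversalPos_of_monoPos h)


/-! ### D1 is the `K = ∅`, `|S| = 1` slice of g20's quotient-monotonicity schema (QS-K) -/

/-- **g20's quotient monotonicity (QS-K) implies D1**: the instance `S = {o}`, `T = Z`, `y' = w`, `K = ∅` of the schema `hQ` of
`…ForestNodeOfQuotientMono` / `…ForestQuotientMono` (with `FM S` = forests separating `S` pairwise) is, after the involution `ω ↦ ω ∆ M`,
exactly `ForestTransversalOn`'s inequality at `(Z; o; w)`.  So the node D1 of `…ForestTransversal` NAMES the `K = ∅` part of g20's house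
conjecture (memo bschramm/FROM-fk-1-g20-SEPARATOR-EXCHANGE.md §3d: star negative correlation), and g31's detour lemma is g20's fixed-path
refinement §3d(a) summed over paths. [cite: SempleWelsh2008, Conj. 1.1 (p. 2)] [cite: Linusson2011, Prop. 2.6] -/
theorem forestTransversalOn_of_quotientMono (FM : Set V → Set (BondConfig V))
    (hFM : ∀ (S : Set V) (ω : BondConfig V),
      ω ∈ FM S ↔ IsForestCfg ω ∧ ∀ x ∈ S, ∀ x' ∈ S, (openGraph ω).Reachable x x' → x = x')
    (hQ : ∀ (M' u' K : BondConfig V) (S T : Set V) (y' : V), Disjoint u' M' → K ⊆ M' → S ⊆ T → y' ∉ T →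
      (∀ e ∈ K, ∀ x ∈ e, x ∈ T) →
      fibreCount M' u' (FM S ∩ {ω | K ⊆ ω}) (FM (insert y' T)) ≤ fibreCount M' u' (FM (insert y' S) ∩ {ω | K ⊆ ω}) (FM T)) :
    ForestTransversalOn V := by
  intro M u₀ hd Z o w hoZ hwZ
  have how : o ≠ w := fun h => hwZ (h ▸ hoZ)
  -- membership translations
  have hcoe : ∀ (Z' : Finset V) (ω : BondConfig V), ω ∈ FM (Z' : Set V) ↔ ω ∈ forestEv V ∩ transvEv Z' := by
    intro Z' ω
    rw [hFM]
    constructor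
    · rintro ⟨hF, h⟩
      exact ⟨hF, fun z hz z' hz' hne hr => hne (h z (Finset.mem_coe.2 hz) z' (Finset.mem_coe.2 hz') hr)⟩
    · rintro ⟨hF, h⟩
      refine ⟨hF, fun x hx x' hx' hr => ?_⟩
      by_contra hne
      exact h (Finset.mem_coe.1 hx) (Finset.mem_coe.1 hx') hne hr
  have hsing : ∀ ω : BondConfig V, ω ∈ FM ({o} : Set V) ∩ {ω | (∅ : BondConfig V) ⊆ ω} ↔ ω ∈ forestEv V := by
    intro ω
    rw [mem_inter_iff, hFM]
    constructor
    · rintro ⟨⟨hF, -⟩, -⟩; exact hF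
    · intro hF
      exact ⟨⟨hF, fun x hx x' hx' _ => (mem_singleton_iff.1 hx).trans (mem_singleton_iff.1 hx').symm⟩, empty_subset _⟩
  have hpair : ∀ ω : BondConfig V, ω ∈ FM (insert w ({o} : Set V)) ∩ {ω | (∅ : BondConfig V) ⊆ ω} ↔
      ω ∈ forestEv V ∩ (reachEv o w)ᶜ := by
    intro ω
    rw [mem_inter_iff, hFM]
    constructor
    · rintro ⟨⟨hF, h⟩, -⟩
      exact ⟨hF, fun hr => how (h o (mem_insert_of_mem _ rfl) w (mem_insert _ _) hr)⟩
    · rintro ⟨hF, hsep⟩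
      refine ⟨⟨hF, fun x hx x' hx' hr => ?_⟩, empty_subset _⟩
      have hsep' : ¬ (openGraph ω).Reachable o w := hsep
      rcases mem_insert_iff.1 hx with rfl | hx
      · rcases mem_insert_iff.1 hx' with rfl | hx'
        · rfl
        · rw [mem_singleton_iff.1 hx'] at hr; exact absurd hr.symm hsep'
      · rw [mem_singleton_iff.1 hx] at hr ⊢
        rcases mem_insert_iff.1 hx' with rfl | hx'
        · exact absurd hr hsep'
        · exact (mem_singleton_iff.1 hx').symm
  have key := hQ M u₀ ∅ ({o} : Set V) (Z : Set V) w hd (empty_subset _)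
    (singleton_subset_iff.2 (Finset.mem_coe.2 hoZ)) (fun h => hwZ (Finset.mem_coe.1 h)) (fun e he => absurd he (notMem_empty e))
  rw [fibreCount_swap M u₀ (FM {o} ∩ _), fibreCount_swap M u₀ (FM (insert w {o}) ∩ _), ← Finset.coe_insert] at key
  calc fibreCount M u₀ (forestEv V ∩ transvEv (insert w Z)) (forestEv V)
      = fibreCount M u₀ (FM ((insert w Z : Finset V) : Set V)) (FM ({o} : Set V) ∩ {ω | (∅ : BondConfig V) ⊆ ω}) :=
        fibreCount_congr_fibre M u₀ fun ω _ => by rw [hcoe, hsing]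
    _ ≤ fibreCount M u₀ (FM (Z : Set V)) (FM (insert w ({o} : Set V)) ∩ {ω | (∅ : BondConfig V) ⊆ ω}) := key
    _ = fibreCount M u₀ (forestEv V ∩ transvEv Z) (forestEv V ∩ (reachEv o w)ᶜ) :=
        fibreCount_congr_fibre M u₀ fun ω _ => by rw [hcoe, hpair]

end MonoToTransversal

end FK
end Summit.CriticalPhenomena.PercolationContinuityZ3.Theorems

end
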